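import Mathlib
import HarnessLib

/-!
# `NoHeavyLowerTail` (crux stmt-CriticalPhenomena-4575), antipodal-Kleitman programme: BALANCING FLOWS — a flow rule (of any degree) proves AK;
# condition systems (the degree-one case, THEOREM K's abstract form)

Support file (seat `prim-ineq-gen-7` gen 50; `--supports stmt-CriticalPhenomena-4575`, closed crux).  No `sorry`, no definitions; standard axioms.
Memo: `run/shared/lean/prim/prim-ineq-gen-7/FINDING-FLOW-g50.md` §1–§2.

SETTING.  `X` a finite partial order, `ι : X → X` any map (the antipode), AK in the functional form of `AntitheticProduct.antipodalKleitman_prod`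
(unit weights): `0 ≤ ∑ x, f x * (g x − g (ι x))` for all monotone `f, g`.  A FLOW is a nonnegative function on a finite set `E` of *upward edges*
`e` (endpoints `src e ≤ tgt e`).  LP duality (memo §1) says AK holds iff for every monotone `g` there is a flow `φ_g` BALANCING `g − g ∘ ι`:
`(flow into z) − (flow out of z) = g z − g (ι z)` for every `z`.  This file proves the easy (and, for the programme, operative) direction:
* `AntitheticFlowRule.flow_rule_ak` — THEOREM F: if every monotone `g` admits a balancing flow, then AK.  PROOF: `∑_z f z (g z − g (ι z))
  = ∑_e φ_g e · (f (tgt e) − f (src e)) ≥ 0`.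
* `AntitheticFlowRule.condition_system_ak` — degree-one rules (CONDITION SYSTEMS, memo §2b): weights `w e ≥ 0` and *condition pairs*
  `p e ≤ q e` with the boundary identity `∑_{tgt e = z} w e (g (q e) − g (p e)) − ∑_{src e = z} w e (g (q e) − g (p e)) = g z − g (ι z)` for all
  monotone `g` and all `z` give AK (take `φ_g e = w e · (g (q e) − g (p e))`).  THEOREM K of the memo (Boolean lattices: support `s → s ∪ e`,
  condition the translate by `{e' > e}`) and ι-invariant chains are instances; products of condition systems are condition systems.
-/

namespace Summit.CriticalPhenomena.PercolationContinuityZ3.Theorems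

open Finset

namespace AntitheticFlowRule

variable {X : Type*} [Fintype X] [DecidableEq X] [PartialOrder X]
variable {E : Type*} [Fintype E]

/-- **THEOREM F (balancing flows prove antipodal Kleitman).**  `src e ≤ tgt e` are the edges; if for every monotone `g : X → ℝ` there is a
nonnegative `φ g : E → ℝ` with `∑_{tgt e = z} φ g e − ∑_{src e = z} φ g e = g z − g (ι z)` for all `z`, then
`0 ≤ ∑ x, f x * (g x − g (ι x))` for all monotone `f, g`. [this work] -/
theorem flow_rule_ak (ι : X → X) (src tgt : E → X) (hst : ∀ e, src e ≤ tgt e)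
    (φ : (X → ℝ) → E → ℝ) (hφ : ∀ g : X → ℝ, Monotone g → ∀ e, 0 ≤ φ g e)
    (hdiv : ∀ g : X → ℝ, Monotone g → ∀ z : X,
      (∑ e ∈ univ.filter (fun e => tgt e = z), φ g e) - (∑ e ∈ univ.filter (fun e => src e = z), φ g e) = g z - g (ι z))
    (f g : X → ℝ) (hf : Monotone f) (hg : Monotone g) :
    0 ≤ ∑ x, f x * (g x - g (ι x)) := by
  have h1 : ∀ z, f z * (g z - g (ι z)) =
      (∑ e ∈ univ.filter (fun e => tgt e = z), f (tgt e) * φ g e) - (∑ e ∈ univ.filter (fun e => src e = z), f (src e) * φ g e) := by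
    intro z
    rw [← hdiv g hg z, mul_sub, Finset.mul_sum, Finset.mul_sum]
    congr 1
    · refine Finset.sum_congr rfl (fun e he => ?_)
      rw [(Finset.mem_filter.1 he).2]
    · refine Finset.sum_congr rfl (fun e he => ?_)
      rw [(Finset.mem_filter.1 he).2]
  have h2 : ∑ z, f z * (g z - g (ι z)) = (∑ e, f (tgt e) * φ g e) - (∑ e, f (src e) * φ g e) := by
    rw [Finset.sum_congr rfl (fun z _ => h1 z), Finset.sum_sub_distrib]
    congr 1
    · exact Finset.sum_fiberwise_of_maps_to (fun e _ => Finset.mem_univ (tgt e)) (fun e => f (tgt e) * φ g e)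
    · exact Finset.sum_fiberwise_of_maps_to (fun e _ => Finset.mem_univ (src e)) (fun e => f (src e) * φ g e)
  rw [h2, ← Finset.sum_sub_distrib]
  refine Finset.sum_nonneg (fun e _ => ?_)
  have hfe : f (src e) ≤ f (tgt e) := hf (hst e)
  have hpe : 0 ≤ φ g e := hφ g hg e
  nlinarith

/-- **Condition systems (degree-one flow rules) prove AK.**  Edges `src e ≤ tgt e` with weights `0 ≤ w e` and condition pairs `p e ≤ q e`
such that for every monotone `g` and every `z`,
`∑_{tgt e = z} w e (g (q e) − g (p e)) − ∑_{src e = z} w e (g (q e) − g (p e)) = g z − g (ι z)` (for integer weights this is the boundary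
identity `∑_{tgt e = z} w e (q e − p e) − ∑_{src e = z} w e (q e − p e) = z − ι z` in `ℤ[X]`).  Then AK in the functional form.  THEOREM K
(Boolean lattices) and products of ι-invariant chains are instances. [this work] -/
theorem condition_system_ak (ι : X → X) (src tgt p q : E → X) (hst : ∀ e, src e ≤ tgt e) (hpq : ∀ e, p e ≤ q e)
    (w : E → ℝ) (hw : ∀ e, 0 ≤ w e)
    (hbd : ∀ g : X → ℝ, Monotone g → ∀ z : X,
      (∑ e ∈ univ.filter (fun e => tgt e = z), w e * (g (q e) - g (p e))) -
        (∑ e ∈ univ.filter (fun e => src e = z), w e * (g (q e) - g (p e))) = g z - g (ι z))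
    (f g : X → ℝ) (hf : Monotone f) (hg : Monotone g) :
    0 ≤ ∑ x, f x * (g x - g (ι x)) := by
  refine flow_rule_ak ι src tgt hst (fun g e => w e * (g (q e) - g (p e))) ?_ hbd f g hf hg
  intro g' hg' e
  have : g' (p e) ≤ g' (q e) := hg' (hpq e)
  have := hw e
  nlinarith

end AntitheticFlowRule

end Summit.CriticalPhenomena.PercolationContinuityZ3.Theorems
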